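import Summits.Ventures.Crystal3D.Theorems.StickyWulffConstantCoaxialWallLawClassCollapse
import Summits.Ventures.Crystal3D.Theorems.StickyWulffConstantCoaxialWallLawEndRowJointDefs
import HarnessLib

/-!
# Chain prefixes: a class of the plate frame `L̃` whose word extends a word `κ₀` is a class of the frame `Fw κ₀` (non-degenerate transfer)
# (crux `CoaxialWallLaw`, stmt-Ventures-19481; brick (L2′) of MODULE-CAPTURE-PLAN-g10 §6–§7 for `stub_moduleCapture`)

HONEST FRAMING. Venture `Summits/Ventures/Crystal3D` (cell `crystal3d-full`); helper `--supports` the crux `CoaxialWallLaw`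
(stmt-Ventures-19481, `route-Ventures-StickyWulffConstant`), registered line 'CoaxialWallLawCertificates' (planner cf-p1).  Census-free
algebra; F-C1 not moved.  For the generalized class collapse (deep case of `ModuleCapture`), the classes of a deep plate frame `L̃` have to be
re-read as classes of the STANDARD frame `F = Fw κ₀` of a minimal firing class.  Reduced-word rigidity (`…ReducedWordRigidity`) will show that
every other standard class has a word `P ++ κ₀'` (`κ₀' = κ₀` up to letter signs, `|P| ≤ 3`); this file supplies the bookkeeping that turns such
a word into a class of the base frame `Fw κ₀'` with the SAME frame and direction:
* `PlateSystem.fw_append` — `S.Fw (P ++ κ) = (⟨S.Fw κ, R⟩ : PlateSystem).Fw P` (the base frame acts last);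
* `wfChain_prefix` — `WFChain r (P ++ κ) → WFChain ((−1)^{|κ|} • r) P` (the prefix is a well-formed chain of the sign-adjusted root);
* `neg_one_pow_smul_mem_basalHexagon` — `(−1)^n • r ∈ basalHexagon` for `r ∈ basalHexagon`;
* **`adm_basalSystem_of_append`** — if `(G, d)` is the class of the word `P ++ κ` of the root `r` for `basalSystem L̃`, then `(G, d)` is the
  class of the word `P` of the root `(−1)^{|κ|} r` for `basalSystem (Fw κ)`: `(basalSystem ((basalSystem L̃).Fw κ)).Adm G d`.
WHAT THIS IS NOT: not the collapse (rigidity + minimality + the 8-dozen partner words) nor `ModuleCapture`; F-C1 not moved.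
-/

noncomputable section

namespace Summit.Ventures.Crystal3D.Theorems

open Summit.Ventures.Crystal3D Finset
open scoped InnerProductSpace

namespace PlateSystem

/-- **The base frame acts last**: the frame of a concatenated word is the frame of the prefix over the base frame of the suffix. -/
theorem fw_append (S : PlateSystem) (P κ : List (EuclideanSpace ℝ (Fin 3))) :
    S.Fw (P ++ κ) = (⟨S.Fw κ, S.RT⟩ : PlateSystem).Fw P := by
  induction P with
  | nil => rfl
  | cons p P ih => rw [List.cons_append, fw_cons, ih, fw_cons]

/-- The same with an arbitrary root set on the new base. -/
theorem fw_append' (S : PlateSystem) (R : Finset (EuclideanSpace ℝ (Fin 3))) (P κ : List (EuclideanSpace ℝ (Fin 3))) :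
    S.Fw (P ++ κ) = (⟨S.Fw κ, R⟩ : PlateSystem).Fw P := by
  induction P with
  | nil => rfl
  | cons p P ih => rw [List.cons_append, fw_cons, ih, fw_cons]

end PlateSystem

/-- **The prefix of a well-formed chain is a well-formed chain of the sign-adjusted root.** -/
theorem wfChain_prefix (r : EuclideanSpace ℝ (Fin 3)) :
    ∀ P κ : List (EuclideanSpace ℝ (Fin 3)), WFChain r (P ++ κ) → WFChain (((-1 : ℝ) ^ κ.length) • r) P := by
  intro P
  induction P with
  | nil => intro κ _; exact PlateSystem.wfChain_nil _
  | cons p P ih =>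
    intro κ h
    rw [List.cons_append, PlateSystem.wfChain_cons] at h
    obtain ⟨hrest, hp1, hmenu, hcross, hnc⟩ := h
    rw [PlateSystem.wfChain_cons]
    refine ⟨ih κ hrest, hp1, hmenu, ?_, ?_⟩
    · rw [smul_smul, ← pow_add, ← List.length_append]; exact hcross
    · intro μ' κ' hP
      exact hnc μ' (κ' ++ κ) (by rw [hP, List.cons_append])

/-- `(−1)^n • r` stays in the basal hexagon. -/
theorem neg_one_pow_smul_mem_basalHexagon {r : EuclideanSpace ℝ (Fin 3)} (hr : r ∈ basalHexagon) (n : ℕ) :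
    ((-1 : ℝ) ^ n) • r ∈ basalHexagon := by
  rcases neg_one_pow_eq_or ℝ n with h | h
  · rw [h, one_smul]; exact hr
  · rw [h, neg_smul, one_smul]
    unfold basalHexagon at hr ⊢
    rw [Finset.mem_filter] at hr ⊢
    refine ⟨neg_mem_fccSlots hr.1, ?_⟩
    show (-r) 2 = 0
    rw [PiLp.neg_apply, hr.2, neg_zero]

/-- **NON-DEGENERATE CLASS TRANSFER.**  The class of the word `P ++ κ` (root `r`) of `basalSystem L̃` IS the class of the word `P` (root
`(−1)^{|κ|} r`) of `basalSystem ((basalSystem L̃).Fw κ)` — same frame, same direction. -/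
theorem adm_basalSystem_of_append (L : EuclideanSpace ℝ (Fin 3) ≃ₗᵢ[ℝ] EuclideanSpace ℝ (Fin 3)) {r : EuclideanSpace ℝ (Fin 3)}
    (hr : r ∈ basalHexagon) (P κ : List (EuclideanSpace ℝ (Fin 3))) (hwf : WFChain r (P ++ κ)) :
    (basalSystem ((basalSystem L).Fw κ)).Adm ((basalSystem L).Fw (P ++ κ))
      (((basalSystem L).Fw (P ++ κ)) (((-1 : ℝ) ^ (P ++ κ).length) • r)) := by
  refine ⟨((-1 : ℝ) ^ κ.length) • r, neg_one_pow_smul_mem_basalHexagon hr _, P, wfChain_prefix r P κ hwf, ?_, ?_⟩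
  · exact PlateSystem.fw_append' (basalSystem L) basalHexagon P κ
  · have e : (basalSystem ((basalSystem L).Fw κ)).Fw P = (basalSystem L).Fw (P ++ κ) :=
      (PlateSystem.fw_append' (basalSystem L) basalHexagon P κ).symm
    rw [e, smul_smul, ← pow_add, List.length_append]

/-- The same transfer for an ARBITRARY class `(G, d)` given by a word of the form `P ++ κ`. -/
theorem adm_transfer_of_append (L : EuclideanSpace ℝ (Fin 3) ≃ₗᵢ[ℝ] EuclideanSpace ℝ (Fin 3)) {r : EuclideanSpace ℝ (Fin 3)}
    (hr : r ∈ basalHexagon) (P κ : List (EuclideanSpace ℝ (Fin 3))) (hwf : WFChain r (P ++ κ))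
    {G : EuclideanSpace ℝ (Fin 3) ≃ₗᵢ[ℝ] EuclideanSpace ℝ (Fin 3)} {d : EuclideanSpace ℝ (Fin 3)}
    (hG : G = (basalSystem L).Fw (P ++ κ)) (hd : d = G (((-1 : ℝ) ^ (P ++ κ).length) • r)) :
    (basalSystem ((basalSystem L).Fw κ)).Adm G d := by
  subst hG; subst hd
  exact adm_basalSystem_of_append L hr P κ hwf

end Summit.Ventures.Crystal3D.Theorems

end
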